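import Summits.SmoothPoincare4.SmoothPoincare4.Theorems.ConvexBisectionAcyclicBisectionExistsEOneCurveGeometry
import Summits.SmoothPoincare4.SmoothPoincare4.Theorems.ConvexBisectionAcyclicBisectionExistsChartedChainCycleOrient
import HarnessLib

/-!
# The annulus chart of the `e_1`-curve: an explicit square root over the round four-point loop
(wave 7, brick H5-2 of the last geometric input (R-E1CURVE) of node N3a `node_STcurve` of stub
`stub_STgeo` = NF4 N3, line `modp-braid-orbits`, crux `ConvexBisection.AcyclicBisectionExists`,
item stmt-SmoothPoincare4-10508; registered sub-goal `helper_eoChart_mem_page`)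

Sequel of `…EOneCurveGeometry.lean`.  Over the annulus `R − 2κ < ‖x − c₀‖ < R + 2κ` of the
`x`-plane around the round loop (centre `c₀ = eoCenter g`, radius `R = eoRad g`, half-width
`κ = eoKap g`), which contains no branch point and whose circles enclose exactly `ζ_0, …, ζ_3`
(`helper_eOne_radii`), the central page `y² = x^{2g+1} + 1 = ∏ₖ (x − ζ_k)` has the EXPLICIT
holomorphic square root

  `eoY x = (x − c₀)² ∏_{k<4} √(1 − (ζ_k − c₀)/(x − c₀)) · ∏_{4 ≤ k ≤ 2g} √(c₀ − ζ_k) √(1 + (x − c₀)/(c₀ − ζ_k))`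

(principal roots; every radicand depending on `x` lies in the disc `‖z − 1‖ < 1` of the right
half-plane, so `eoY` is holomorphic and `eoY² = x^{2g+1} + 1` by regrouping the factors — an even
number of enclosed branch points is exactly what makes the monodromy trivial).  The ANNULUS CHART of
node N1a around the `e_1`-curve of the page `page g 1` is then

  `eoChart (u, r) = pagePt g 1 (x, eoY x)`,  `x = eoX g (u, r) = c₀ + eoRadP g r · e^{2πiu}`,

with the radial profile `eoRadP g r = R − κ sin(πr/2)` DECREASING in `r`.  This file proves the
derivative-free chart hypotheses (values in `page g 1` — `helper_eoChart_mem_page`, using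
`‖x‖ ≤ 1.78` and `(3/2)^{1/(2g+1)} ≤ 1.09` —, `1`-periodicity, injectivity on `[0,1) × [−1,1]`,
smoothness of the ambient map); smoothness into the base, the core circle and the orientation
are the sequel.
Everything is proved; no `sorry`.  References: J. Milnor, *Singular points of complex
hypersurfaces* (1968), §9 [Milnor1968].
-/

noncomputable section

set_option linter.dupNamespace false

open scoped Manifold ContDiff Topology ComplexConjugate Real
open Set Function Metric Complex
open Literature.Topology.FourManifolds Literature.Topology.FourManifolds.LefschetzBase
  Literature.Topology.FourManifolds.TorusKnotMilnor

namespace Summit.SmoothPoincare4.SmoothPoincare4.Theorems.AcyclicBisectionExists.ModpBraidOrbits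

variable {g : ℕ}

/-! ## §1 The radial profile and the `x`-coordinate of the chart -/

/-- **The radial profile** `eoRadP g r = R − κ sin(πr/2)`, decreasing on `[−1, 1]` from `R + κ`
to `R − κ`. [folklore] -/
def eoRadP (g : ℕ) (r : ℝ) : ℝ := eoRad g - eoKap g * Real.sin (π * r / 2)

/-- `κ > 0` (`g ≥ 1`). [folklore] -/
theorem eoKap_pos (hg : 1 ≤ g) : 0 < eoKap g := by
  have := cmid_lt_one hg; unfold eoKap; linarith

/-- `R − κ ≤ eoRadP r ≤ R + κ`. [folklore] -/
theorem eoRadP_mem (hg : 1 ≤ g) (r : ℝ) : eoRadP g r ∈ Icc (eoRad g - eoKap g) (eoRad g + eoKap g) := by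
  have h1 := Real.sin_le_one (π * r / 2)
  have h2 := Real.neg_one_le_sin (π * r / 2)
  have hk := eoKap_pos hg
  unfold eoRadP
  constructor <;> nlinarith

/-- `eoRadP 0 = R`. [folklore] -/
@[simp] theorem eoRadP_zero (g : ℕ) : eoRadP g 0 = eoRad g := by simp [eoRadP]

/-- `0 < eoRadP` (`g ≥ 2`). [folklore] -/
theorem eoRadP_pos (hg : 2 ≤ g) (r : ℝ) : 0 < eoRadP g r := by
  have := (eoRadP_mem (by omega : 1 ≤ g) r).1
  have := eoRad_ge g; have := (eoKap_bounds hg).2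
  linarith

/-- The profile is smooth. [folklore] -/
theorem contDiff_eoRadP (g : ℕ) : ContDiff ℝ ∞ (eoRadP g) := by
  unfold eoRadP; fun_prop

/-- The derivative of the profile: `−κ cos(πr/2) π/2`. [folklore] -/
theorem hasDerivAt_eoRadP (g : ℕ) (r : ℝ) :
    HasDerivAt (eoRadP g) (-(eoKap g * (Real.cos (π * r / 2) * (π / 2)))) r := by
  unfold eoRadP
  have h1 : HasDerivAt (fun r : ℝ => π * r / 2) (π / 2) r := by
    simpa using ((hasDerivAt_id r).const_mul π).div_const 2
  have h2 := ((Real.hasDerivAt_sin (π * r / 2)).comp r h1).const_mul (eoKap g)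
  exact h2.const_sub (eoRad g)

/-- On `(−1, 1)` the profile has negative derivative (`g ≥ 1`). [folklore] -/
theorem deriv_eoRadP_neg (hg : 1 ≤ g) {r : ℝ} (hr : r ∈ Ioo (-1 : ℝ) 1) : deriv (eoRadP g) r < 0 := by
  rw [(hasDerivAt_eoRadP g r).deriv]
  have hc : 0 < Real.cos (π * r / 2) := by
    refine Real.cos_pos_of_mem_Ioo ⟨?_, ?_⟩ <;> nlinarith [Real.pi_pos, hr.1, hr.2]
  have := eoKap_pos hg
  have : 0 < eoKap g * (Real.cos (π * r / 2) * (π / 2)) := by positivity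
  linarith

/-- **The profile is strictly decreasing on `[−1, 1]`** (`g ≥ 1`). [folklore] -/
theorem strictAntiOn_eoRadP (hg : 1 ≤ g) : StrictAntiOn (eoRadP g) (Icc (-1 : ℝ) 1) := by
  intro a ha b hb hab
  unfold eoRadP
  have hs : Real.sin (π * a / 2) < Real.sin (π * b / 2) := by
    refine Real.strictMonoOn_sin ⟨?_, ?_⟩ ⟨?_, ?_⟩ ?_ <;>
      nlinarith [Real.pi_pos, ha.1, ha.2, hb.1, hb.2]
  have := eoKap_pos hg
  nlinarith

/-- **The `x`-coordinate of the chart**: `eoX g (u, r) = c₀ + eoRadP g r · e^{2πiu}`. [folklore] -/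
def eoX (g : ℕ) (p : ℝ × ℝ) : ℂ :=
  eoCenter g + (eoRadP g p.2 : ℂ) * cexp (((2 * π * p.1 : ℝ) : ℂ) * I)

/-- `‖eoX p − c₀‖ = eoRadP r`. [folklore] -/
theorem norm_eoX_sub_center (hg : 2 ≤ g) (p : ℝ × ℝ) : ‖eoX g p - eoCenter g‖ = eoRadP g p.2 := by
  rw [eoX, add_sub_cancel_left, norm_mul, Complex.norm_real, Complex.norm_exp_ofReal_mul_I, mul_one,
    Real.norm_eq_abs, abs_of_pos (eoRadP_pos hg _)]

/-- **The chart annulus**: `R − κ ≤ ‖eoX p − c₀‖ ≤ R + κ`. [folklore] -/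
theorem norm_eoX_sub_center_mem (hg : 2 ≤ g) (p : ℝ × ℝ) :
    ‖eoX g p - eoCenter g‖ ∈ Icc (eoRad g - eoKap g) (eoRad g + eoKap g) := by
  rw [norm_eoX_sub_center hg]; exact eoRadP_mem (by omega) _

/-- `‖eoX p‖ ≤ 1.78`. [folklore] -/
theorem norm_eoX_le (hg : 2 ≤ g) (p : ℝ × ℝ) : ‖eoX g p‖ ≤ 1.78 := by
  have h1 : ‖eoX g p‖ ≤ ‖eoX g p - eoCenter g‖ + ‖eoCenter g‖ := by
    calc ‖eoX g p‖ = ‖(eoX g p - eoCenter g) + eoCenter g‖ := by rw [sub_add_cancel]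
      _ ≤ _ := norm_add_le _ _
  rw [norm_eoCenter] at h1
  have h2 := (norm_eoX_sub_center_mem hg p).2
  have h3 := center_add_rad_add_kap_le hg
  linarith

/-- `eoX` is `1`-periodic in `u`. [folklore] -/
theorem eoX_periodic (g : ℕ) (u r : ℝ) : eoX g (u + 1, r) = eoX g (u, r) := by
  unfold eoX
  dsimp only
  rw [show (((2 * π * (u + 1) : ℝ)) : ℂ) * I = ((2 * π * u : ℝ) : ℂ) * I + 2 * π * I by push_cast; ring,
    Complex.exp_add, Complex.exp_two_pi_mul_I, mul_one]

/-- **`eoX` is injective on `[0, 1) × [−1, 1]`** (the radius gives `r`, the phase gives `u`).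
[folklore] -/
theorem eoX_injOn (hg : 2 ≤ g) : InjOn (eoX g) (Ico (0 : ℝ) 1 ×ˢ Icc (-1 : ℝ) 1) := by
  rintro ⟨u, r⟩ ⟨hu, hr⟩ ⟨u', r'⟩ ⟨hu', hr'⟩ h
  have hn := congrArg (fun z => ‖z - eoCenter g‖) h
  simp only [norm_eoX_sub_center hg] at hn
  have hrr : r = r' := (strictAntiOn_eoRadP (by omega : 1 ≤ g)).injOn hr hr' hn
  subst hrr
  have hρ : ((eoRadP g r : ℝ) : ℂ) ≠ 0 := by exact_mod_cast (eoRadP_pos hg r).ne'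
  have h' : (eoRadP g r : ℂ) * cexp (((2 * π * u : ℝ) : ℂ) * I) =
      (eoRadP g r : ℂ) * cexp (((2 * π * u' : ℝ) : ℂ) * I) := by
    have := congrArg (fun z => z - eoCenter g) h
    simpa [eoX] using this
  have he := mul_left_cancel₀ hρ h'
  obtain ⟨n, hn'⟩ := Complex.exp_eq_exp_iff_exists_int.1 he
  have him := congrArg Complex.im hn'
  simp at him
  have hpi : u = u' + n := by
    have := Real.pi_pos
    field_simp at him
    nlinarith [him]
  have hn0 : (n : ℝ) = 0 := by
    have h1 : (-1 : ℝ) < n := by linarith [hu.1, hu.2, hu'.1, hu'.2]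
    have h2 : (n : ℝ) < 1 := by linarith [hu.1, hu.2, hu'.1, hu'.2]
    have h1' : (-1 : ℤ) < n := by exact_mod_cast h1
    have h2' : n < 1 := by exact_mod_cast h2
    have : n = 0 := by omega
    exact_mod_cast this
  rw [hn0, add_zero] at hpi
  rw [hpi]

/-- `eoX` is smooth. [folklore] -/
theorem contDiff_eoX (g : ℕ) : ContDiff ℝ ∞ (eoX g) := by
  unfold eoX
  refine contDiff_const.add (ContDiff.mul (Complex.ofRealCLM.contDiff.comp ((contDiff_eoRadP g).comp contDiff_snd)) ?_)
  refine Complex.contDiff_exp.comp ?_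
  exact (Complex.ofRealCLM.contDiff.comp (contDiff_const.mul contDiff_fst)).mul contDiff_const

/-- **`∂ᵤ eoX = (x − c₀) · 2πi`.** [folklore] -/
theorem hasDerivAt_eoX_u (g : ℕ) (u r : ℝ) :
    HasDerivAt (fun u' => eoX g (u', r))
      ((eoRadP g r : ℂ) * cexp (((2 * π * u : ℝ) : ℂ) * I) * (2 * π * I)) u := by
  have h1 : HasDerivAt (fun u' : ℝ => (((2 * π * u' : ℝ)) : ℂ) * I) ((2 * π : ℝ) * I) u := by
    have h := ((hasDerivAt_id u).const_mul (2 * π)).ofReal_comp.mul_const I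
    simpa using h
  have h2 := (h1.cexp.const_mul ((eoRadP g r : ℝ) : ℂ)).const_add (eoCenter g)
  refine h2.congr_deriv ?_
  push_cast; ring

/-- **`∂ᵣ eoX = eoRadP' r · e^{2πiu}`.** [folklore] -/
theorem hasDerivAt_eoX_r (g : ℕ) (u r : ℝ) :
    HasDerivAt (fun r' => eoX g (u, r'))
      (((deriv (eoRadP g) r : ℝ) : ℂ) * cexp (((2 * π * u : ℝ) : ℂ) * I)) r := by
  have h := (((hasDerivAt_eoRadP g r).ofReal_comp).mul_const (cexp (((2 * π * u : ℝ) : ℂ) * I))).const_add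
    (eoCenter g)
  rw [(hasDerivAt_eoRadP g r).deriv]
  exact h

/-! ## §2 The explicit square root over the annulus -/

/-- **The explicit square root** of `x^{2g+1} + 1` over the annulus of the four-point loop.
[cite: Milnor1968, §9] -/
def eoY (g : ℕ) (x : ℂ) : ℂ :=
  (x - eoCenter g) ^ 2 *
    (∏ k ∈ Finset.range 4, csqrt (1 - (branchPt g k - eoCenter g) / (x - eoCenter g))) *
    ∏ k ∈ Finset.Ico 4 (2 * g + 1),
      (csqrt (eoCenter g - branchPt g k) * csqrt (1 + (x - eoCenter g) / (eoCenter g - branchPt g k)))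

/-- A complex number `1 + w` with `‖w‖ < 1` lies in the slit plane. [folklore] -/
theorem one_add_mem_slitPlane_of_norm {w : ℂ} (hw : ‖w‖ < 1) : 1 + w ∈ slitPlane :=
  one_add_mem_slitPlane (abs_lt.1 (lt_of_le_of_lt (Complex.abs_re_le_norm w) hw)).1

variable {x : ℂ}

/-- Inner radicands: `‖(ζ_k − c₀)/(x − c₀)‖ < 1` for `k < 4` on the annulus. [folklore] -/
theorem norm_inner_ratio_lt (hg : 2 ≤ g) (hx : eoRad g - 2 * eoKap g < ‖x - eoCenter g‖) {k : ℕ} (hk : k < 4) :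
    ‖(branchPt g k - eoCenter g) / (x - eoCenter g)‖ < 1 := by
  have h1 := (helper_eOne_radii g hg k).1 hk
  obtain ⟨hk0, hk1⟩ := eoKap_bounds hg
  have hpos : 0 < ‖x - eoCenter g‖ := by have := eoRad_ge g; linarith
  rw [norm_div, div_lt_one hpos]; linarith

/-- Outer radicands: `‖(x − c₀)/(c₀ − ζ_k)‖ < 1` for `4 ≤ k ≤ 2g` on the annulus. [folklore] -/
theorem norm_outer_ratio_lt (hg : 2 ≤ g) (hx : ‖x - eoCenter g‖ < eoRad g + 2 * eoKap g) {k : ℕ} (hk : 4 ≤ k)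
    (hkn : k < 2 * g + 1) : ‖(x - eoCenter g) / (eoCenter g - branchPt g k)‖ < 1 := by
  have h1 := (helper_eOne_radii g hg k).2 hk hkn
  have hpos : 0 < ‖eoCenter g - branchPt g k‖ := by
    rw [norm_sub_rev]; have := eoRad_ge g; have := (eoKap_bounds hg).1; linarith
  rw [norm_div, div_lt_one hpos, norm_sub_rev (eoCenter g)]; linarith

/-- `x ≠ c₀` on the annulus. [folklore] -/
theorem sub_center_ne_zero (hg : 2 ≤ g) (hx : eoRad g - 2 * eoKap g < ‖x - eoCenter g‖) : x - eoCenter g ≠ 0 := by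
  rw [← norm_pos_iff]; have := eoRad_ge g; have := (eoKap_bounds hg).2; linarith

/-- `c₀ ≠ ζ_k` for the excluded branch points. [folklore] -/
theorem center_sub_branchPt_ne_zero (hg : 2 ≤ g) {k : ℕ} (hk : 4 ≤ k) (hkn : k < 2 * g + 1) :
    eoCenter g - branchPt g k ≠ 0 := by
  rw [← norm_pos_iff, norm_sub_rev]
  have := (helper_eOne_radii g hg k).2 hk hkn; have := eoRad_ge g; have := (eoKap_bounds hg).1; linarith

/-- **`eoY² = x^{2g+1} + 1` on the annulus** (regroup `(x − c₀)(1 − (ζ_k − c₀)/(x − c₀)) = x − ζ_k`,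
`(c₀ − ζ_k)(1 + (x − c₀)/(c₀ − ζ_k)) = x − ζ_k`, and `x^{2g+1} + 1 = ∏ (x − ζ_k)`). [folklore] -/
theorem eoY_sq (hg : 2 ≤ g) (hx : eoRad g - 2 * eoKap g < ‖x - eoCenter g‖) :
    eoY g x ^ 2 = x ^ (2 * g + 1) + 1 := by
  have hne := sub_center_ne_zero hg hx
  rw [eoY, mul_pow, mul_pow, ← Finset.prod_pow, ← Finset.prod_pow, pow_add_one_eq_prod,
    ← Finset.prod_range_mul_prod_Ico _ (show 4 ≤ 2 * g + 1 by omega)]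
  have hin : ((x - eoCenter g) ^ 2) ^ 2 * ∏ k ∈ Finset.range 4, csqrt (1 - (branchPt g k - eoCenter g) / (x - eoCenter g)) ^ 2 =
      ∏ k ∈ Finset.range 4, (x - branchPt g k) := by
    have e4 : ((x - eoCenter g) ^ 2) ^ 2 = ∏ _k ∈ Finset.range 4, (x - eoCenter g) := by
      rw [Finset.prod_const, Finset.card_range]; ring
    rw [e4, ← Finset.prod_mul_distrib]
    refine Finset.prod_congr rfl fun k _ => ?_
    rw [csqrt_sq]; field_simp; ring
  have hout : ∏ k ∈ Finset.Ico 4 (2 * g + 1), (csqrt (eoCenter g - branchPt g k) *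
      csqrt (1 + (x - eoCenter g) / (eoCenter g - branchPt g k))) ^ 2 =
      ∏ k ∈ Finset.Ico 4 (2 * g + 1), (x - branchPt g k) := by
    refine Finset.prod_congr rfl fun k hk => ?_
    rw [Finset.mem_Ico] at hk
    have hne' := center_sub_branchPt_ne_zero hg hk.1 hk.2
    rw [mul_pow, csqrt_sq, csqrt_sq]; field_simp; ring
  rw [hin, hout]

/-- A finite product of functions differentiable at `x` is differentiable at `x`. [folklore] -/
theorem differentiableAt_finset_prod {s : Finset ℕ} {F : ℕ → ℂ → ℂ} {x : ℂ}
    (h : ∀ k ∈ s, DifferentiableAt ℂ (F k) x) : DifferentiableAt ℂ (fun y => ∏ k ∈ s, F k y) x := by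
  have e : (fun y => ∏ k ∈ s, F k y) = ∏ k ∈ s, F k := by ext y; exact (Finset.prod_apply y s F).symm
  rw [e]; exact DifferentiableAt.finsetProd h

/-- **`eoY` is holomorphic on the annulus.** [folklore] -/
theorem differentiableAt_eoY (hg : 2 ≤ g) (hx : eoRad g - 2 * eoKap g < ‖x - eoCenter g‖)
    (hx' : ‖x - eoCenter g‖ < eoRad g + 2 * eoKap g) : DifferentiableAt ℂ (eoY g) x := by
  have hne := sub_center_ne_zero hg hx
  unfold eoY csqrt
  refine ((((differentiableAt_id.sub (differentiableAt_const _)).pow 2).mul ?_).mul ?_)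
  · refine differentiableAt_finset_prod fun k hk => ?_
    rw [Finset.mem_range] at hk
    refine DifferentiableAt.cpow ?_ (differentiableAt_const _) ?_
    · exact (differentiableAt_const _).sub ((differentiableAt_const _).div
        (differentiableAt_id.sub (differentiableAt_const _)) hne)
    · rw [sub_eq_add_neg]
      exact one_add_mem_slitPlane_of_norm (by rw [norm_neg]; exact norm_inner_ratio_lt hg hx hk)
  · refine differentiableAt_finset_prod fun k hk => ?_
    rw [Finset.mem_Ico] at hk
    refine (differentiableAt_const _).mul (DifferentiableAt.cpow ?_ (differentiableAt_const _) ?_)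
    · exact (differentiableAt_const _).add ((differentiableAt_id.sub (differentiableAt_const _)).div_const _)
    · exact one_add_mem_slitPlane_of_norm (norm_outer_ratio_lt hg hx' hk.1 hk.2)

/-- The annulus is open. [folklore] -/
theorem isOpen_eoAnn (g : ℕ) :
    IsOpen {x : ℂ | eoRad g - 2 * eoKap g < ‖x - eoCenter g‖ ∧ ‖x - eoCenter g‖ < eoRad g + 2 * eoKap g} := by
  have hc : Continuous fun x : ℂ => ‖x - eoCenter g‖ := by fun_prop
  exact (isOpen_lt continuous_const hc).inter (isOpen_lt hc continuous_const)

/-- **`eoY` is real `C^∞` at every point of the annulus.** [folklore] -/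
theorem contDiffAt_eoY (hg : 2 ≤ g) (hx : eoRad g - 2 * eoKap g < ‖x - eoCenter g‖)
    (hx' : ‖x - eoCenter g‖ < eoRad g + 2 * eoKap g) : ContDiffAt ℝ ∞ (eoY g) x := by
  have hU := isOpen_eoAnn g
  have hd : DifferentiableOn ℂ (eoY g)
      {x : ℂ | eoRad g - 2 * eoKap g < ‖x - eoCenter g‖ ∧ ‖x - eoCenter g‖ < eoRad g + 2 * eoKap g} :=
    fun y hy => (differentiableAt_eoY hg hy.1 hy.2).differentiableWithinAt
  exact ((hd.contDiffOn hU).restrict_scalars ℝ).contDiffAt (hU.mem_nhds ⟨hx, hx'⟩)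

/-- The chart annulus lies in the annulus: `R − 2κ < ‖eoX p − c₀‖ < R + 2κ`. [folklore] -/
theorem eoX_mem_ann (hg : 2 ≤ g) (p : ℝ × ℝ) :
    eoRad g - 2 * eoKap g < ‖eoX g p - eoCenter g‖ ∧ ‖eoX g p - eoCenter g‖ < eoRad g + 2 * eoKap g := by
  have h := norm_eoX_sub_center_mem hg p
  have hk := eoKap_pos (by omega : 1 ≤ g)
  exact ⟨by linarith [h.1], by linarith [h.2]⟩

/-- `eoY (eoX p)² = (eoX p)^{2g+1} + 1`. [folklore] -/
theorem eoY_eoX_sq (hg : 2 ≤ g) (p : ℝ × ℝ) : eoY g (eoX g p) ^ 2 = eoX g p ^ (2 * g + 1) + 1 :=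
  eoY_sq hg (eoX_mem_ann hg p).1

/-! ## §3 The ambient chart and the chart -/

/-- `‖λ‖ ≤ 1.09` for the page of direction `1` and `g ≥ 2` (`(3/2)^{1/5} ≤ 1.09`). [folklore] -/
theorem norm_scaleX_one_le (hg : 2 ≤ g) : ‖scaleX g 1‖ ≤ 1.09 := by
  have hy : ((2 * g + 1 : ℕ) : ℂ)⁻¹ = (((2 * g + 1 : ℕ) : ℝ)⁻¹ : ℝ) := by push_cast; rfl
  have hb : (1 + (1 : ℂ) / 2) = ((3 / 2 : ℝ) : ℂ) := by push_cast; ring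
  rw [scaleX, hy, hb, Complex.norm_cpow_real, Complex.norm_real, Real.norm_eq_abs,
    abs_of_pos (by norm_num : (0:ℝ) < 3 / 2)]
  have hn : ((2 * g + 1 : ℕ) : ℝ)⁻¹ ≤ (5 : ℝ)⁻¹ := by
    refine inv_anti₀ (by norm_num) ?_
    have : (5 : ℕ) ≤ 2 * g + 1 := by omega
    exact_mod_cast this
  calc (3 / 2 : ℝ) ^ (((2 * g + 1 : ℕ) : ℝ)⁻¹) ≤ (3 / 2 : ℝ) ^ ((5 : ℝ)⁻¹) :=
        Real.rpow_le_rpow_of_exponent_le (by norm_num) hn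
    _ ≤ 1.09 := by
        have h : (3 / 2 : ℝ) ≤ 1.09 ^ (5 : ℕ) := by norm_num
        have := Real.rpow_le_rpow (by norm_num) h (by norm_num : (0:ℝ) ≤ (5 : ℝ)⁻¹)
        rwa [show ((5 : ℝ)) = ((5 : ℕ) : ℝ) by norm_num, Real.pow_rpow_inv_natCast (by norm_num) (by norm_num)] at this

/-- A scaled point over `‖x‖ ≤ 1.78` has `‖λ x‖² < 4` (`g ≥ 2`). [folklore] -/
theorem norm_cx_pagePt_one_sq_lt (hg : 2 ≤ g) {x : ℂ} (y : ℂ) (hx : ‖x‖ ≤ 1.78) :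
    ‖cx (pagePt g 1 x y)‖ ^ 2 < 4 := by
  rw [cx_pagePt, norm_mul]
  have h1 := norm_scaleX_one_le hg
  have h2 : ‖scaleX g 1‖ * ‖x‖ ≤ 1.09 * 1.78 :=
    mul_le_mul h1 hx (norm_nonneg _) (by norm_num)
  nlinarith [norm_nonneg (scaleX g 1), norm_nonneg x, mul_nonneg (norm_nonneg (scaleX g 1)) (norm_nonneg x)]

/-- **A scaled point of the central page over `‖x‖ ≤ 1.78` lies in the base and in `page g 1`.**
[folklore] -/
theorem rho_pagePt_one_le (hg : 2 ≤ g) {x y : ℂ} (hy : y ^ 2 = x ^ (2 * g + 1) + 1) (hx : ‖x‖ ≤ 1.78) :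
    rho g (pagePt g 1 x y) ≤ 1 / 4 ∧
      (‖cx (pagePt g 1 x y)‖ ^ 2 < 4 ∧ w g (pagePt g 1 x y) = 1 / 2) := by
  have h4 := norm_cx_pagePt_one_sq_lt hg y hx
  refine ⟨?_, h4, w_pagePt hy⟩
  rw [rho, w_pagePt hy, eta_of_le h4.le]; norm_num

/-- **The ambient annulus chart** `eoAmb g (u, r) = pagePt g 1 (x, eoY x)`, `x = eoX g (u, r)`.
[cite: Milnor1968, §9] -/
def eoAmb (g : ℕ) (p : ℝ × ℝ) : EuclideanSpace ℝ (Fin 4) := pagePt g 1 (eoX g p) (eoY g (eoX g p))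

/-- The ambient chart lands in `{rho ≤ 1/4}`. [folklore] -/
theorem eoAmb_mem (hg : 2 ≤ g) (p : ℝ × ℝ) : eoAmb g p ∈ rho g ⁻¹' Iic (1 / 4 : ℝ) :=
  (rho_pagePt_one_le hg (eoY_eoX_sq hg p) (norm_eoX_le hg p)).1

/-- **The annulus chart of the `e_1`-curve** of `page g 1`. [cite: Milnor1968, §9] -/
def eoChart (hg : 2 ≤ g) : ℝ × ℝ → Base g :=
  (rho g ⁻¹' Iic (1 / 4 : ℝ)).codRestrict (eoAmb g) (eoAmb_mem hg)

/-- The ambient point of the chart. [folklore] -/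
@[simp] theorem eoChart_val (hg : 2 ≤ g) (p : ℝ × ℝ) : (eoChart hg p).1 = eoAmb g p := rfl

/-- **Sub-goal `helper_eoChart_mem_page`** (H5-2 of the `e_1`-curve (R-E1CURVE) for node N3a of NF4):
the annulus chart of the `e_1`-curve takes values in the page `page g 1`. [cite: Milnor1968, §9] -/
theorem helper_eoChart_mem_page : ∀ (g : ℕ) (hg : 2 ≤ g) (p : ℝ × ℝ), Summit.SmoothPoincare4.SmoothPoincare4.Theorems.AcyclicBisectionExists.ModpBraidOrbits.eoChart hg p ∈ Literature.Topology.FourManifolds.LefschetzBase.page g 1 :=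
  fun _ hg p => (rho_pagePt_one_le hg (eoY_eoX_sq hg p) (norm_eoX_le hg p)).2

/-- The chart is `1`-periodic. [folklore] -/
theorem eoChart_periodic (hg : 2 ≤ g) (u r : ℝ) : eoChart hg (u + 1, r) = eoChart hg (u, r) := by
  apply Subtype.ext
  simp only [eoChart_val, eoAmb, eoX_periodic]

/-- **The chart is injective on `[0, 1) × [−1, 1]`.** [folklore] -/
theorem eoChart_injOn' (hg : 2 ≤ g) : InjOn (eoChart hg) (Ico (0 : ℝ) 1 ×ˢ Icc (-1 : ℝ) 1) := by
  intro p hp q hq h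
  have h' := congrArg (fun z : Base g => z.1) h
  simp only [eoChart_val, eoAmb] at h'
  obtain ⟨hx, -⟩ := (pagePt_inj (c := (1 : ℂ)) (by simp)).1 h'
  exact eoX_injOn hg hp hq hx

/-- The chart is injective on the fundamental strip `[0, 1) × (−1, 1)`. [folklore] -/
theorem eoChart_injOn (hg : 2 ≤ g) : InjOn (eoChart hg) (Ico (0 : ℝ) 1 ×ˢ Ioo (-1 : ℝ) 1) :=
  (eoChart_injOn' hg).mono (prod_mono le_rfl Ioo_subset_Icc_self)

/-- **The ambient chart is smooth** (`eoY` is holomorphic along the chart). [folklore] -/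
theorem contDiff_eoAmb (hg : 2 ≤ g) : ContDiff ℝ ∞ (eoAmb g) := by
  rw [contDiff_iff_contDiffAt]
  intro p
  unfold eoAmb pagePt
  refine ContDiffAt.mk₂ (contDiffAt_const.mul (contDiff_eoX g).contDiffAt) (contDiffAt_const.mul ?_)
  exact (contDiffAt_eoY hg (eoX_mem_ann hg p).1 (eoX_mem_ann hg p).2).comp p (contDiff_eoX g).contDiffAt

end Summit.SmoothPoincare4.SmoothPoincare4.Theorems.AcyclicBisectionExists.ModpBraidOrbits

end
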